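import Summits.Parity.GeneralizedHardyLittlewood.Theses.LiouvilleMAD

/-!
# `LambdaLiouvilleLevel` (stmt-Parity-13325): the hypotheses `h ≠ 0` and `y q ≤ N` are load-bearing

NEGATIVE LEMMAS for the crux
`Summit.Parity.GeneralizedHardyLittlewood.Theses.LiouvilleMAD.LambdaLiouvilleLevel`
(Bombieri–Vinogradov at level `N^{ε₀}` for the sequence `Λ(n)λ(n+h)`; route LiouvilleMAD), from the
standing disprover's work file `Cruxes/LambdaLiouvilleLevel/Disproof.lean` (cycle 1). Each variant
below is the crux's `def` body re-typed verbatim with ONE hypothesis deleted, and NEGATED — "any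
proof of the crux must use that hypothesis":

* `lambdaLiouvilleLevel_false_without_hne` — the guard `h ≠ 0` deleted: FALSE at `h = 0`, where the
  `q = 1` term is `|Σ_{n≤N} Λ(n)λ(n)| ≥ ψ(N) - 2(ψ(N) - θ(N)) ≥ N log 2 - log(N+1) - 4√N log N`
  (`λ(p) = -1`; Chebyshev's bounds, Mathlib `Chebyshev.psi_ge`, `Chebyshev.psi_sub_theta_le`),
  against the claimed `C N / log N` (`A = 1`).
* `lambdaLiouvilleLevel_false_without_heightCap` — the cap `∀ q, y q ≤ N` deleted: FALSE, because
  the partial sums `Σ_{n≤Y} Λ(n)λ(n+1)` jump by `log p` at every prime `p` (so they are unbounded in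
  `Y`, `exists_lt_abs_shiftOneSum`) while the right side is frozen at `N = max N₀ 1`.

Not load-bearing (bookkeeping, not formalised): `∃ N₀` is absorbable into `C`, and the guard
`0 < A` is cosmetic. The companion file `LambdaLiouvilleLevelLevelTightness.lean` refutes the
natural strengthenings to level `N/(log N)^B` and to level one; `LambdaLiouvilleLevelHLCFace.lean`
records that the `q = 1` face is quantitative hybrid Hardy–Littlewood–Chowla (depth, not falsity).
Mathlib only (Chebyshev `ψ`, `θ`; `isLittleO_log_rpow_atTop`); no named facts, no defs. [folklore]
-/

namespace Summit.Parity.GeneralizedHardyLittlewood.Theorems.LambdaLiouvilleLevel.Negative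

open Finset Filter Asymptotics
open ArithmeticFunction (vonMangoldt liouville)

/-! ## Small facts about `λ` and the crux's inner sums -/

/-- `|λ(m)| = 1` for `m ≠ 0` (as a real number). [folklore] -/
theorem abs_cast_liouville {m : ℕ} (hm : m ≠ 0) : |((liouville m : ℤ) : ℝ)| = 1 := by
  rw [ArithmeticFunction.liouville_apply hm]
  push_cast
  rw [abs_pow, abs_neg, abs_one, one_pow]

/-- `λ(p) = -1` at a prime `p`. [folklore] -/
theorem liouville_prime {p : ℕ} (hp : p.Prime) : liouville p = -1 := by
  rw [ArithmeticFunction.liouville_apply hp.ne_zero, ArithmeticFunction.cardFactors_apply_prime hp,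
    pow_one]

/-- The class filter at modulus `1` is everything. [folklore] -/
theorem filter_modEq_one (s : Finset ℕ) (w : ℕ) : s.filter (fun n : ℕ => n ≡ w [MOD 1]) = s :=
  Finset.filter_true_of_mem (fun _ _ => Nat.modEq_one)

/-- `1 ∈ [1, ⌊N^{ε₀}⌋]` as soon as `N ≥ 1` and `ε₀ ≥ 0`: the `q = 1` term is always present.
[folklore] -/
theorem one_mem_Icc_floor_rpow {N : ℕ} (hN : 1 ≤ N) {ε₀ : ℝ} (hε₀ : 0 ≤ ε₀) :
    1 ∈ Icc 1 ⌊(N : ℝ) ^ ε₀⌋₊ := by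
  rw [mem_Icc]
  refine ⟨le_rfl, Nat.le_floor ?_⟩
  rw [Nat.cast_one]
  exact Real.one_le_rpow (by exact_mod_cast hN) hε₀

/-! ## Load-bearing hypothesis 1: `h ≠ 0` -/

/-- **Chebyshev lower bound for the diagonal correlation.**
`ψ(N) - 2(ψ(N) - θ(N)) ≤ |Σ_{1 ≤ n ≤ N} Λ(n) λ(n)|`: write `Λλ = -Λ + Λ(λ+1)`; the second term
vanishes at primes (`λ(p) = -1`) and is `≤ 2Λ` elsewhere, i.e. bounded by `2(ψ - θ)` in total
(Mathlib `Chebyshev.psi_sub_theta_eq_sum_not_prime`). [folklore] -/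
theorem psi_sub_le_abs_sum_vonMangoldt_mul_liouville (N : ℕ) :
    Chebyshev.psi N - 2 * (Chebyshev.psi N - Chebyshev.theta N) ≤
      |∑ n ∈ Icc 1 N, vonMangoldt n * ((liouville n : ℤ) : ℝ)| := by
  have hpsi : Chebyshev.psi N = ∑ n ∈ Ioc 0 N, vonMangoldt n := by
    rw [Chebyshev.psi, Nat.floor_natCast]
  have hdiff : Chebyshev.psi N - Chebyshev.theta N =
      ∑ n ∈ (Ioc 0 N).filter (fun n => ¬ n.Prime), vonMangoldt n := by
    rw [Chebyshev.psi_sub_theta_eq_sum_not_prime, Nat.floor_natCast]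
  set E : ℝ := ∑ n ∈ Ioc 0 N, vonMangoldt n * (((liouville n : ℤ) : ℝ) + 1) with hE
  have hIcc : Icc 1 N = Ioc 0 N := by
    ext n
    simp only [mem_Icc, mem_Ioc]
    omega
  have hdecomp : ∑ n ∈ Icc 1 N, vonMangoldt n * ((liouville n : ℤ) : ℝ) =
      -(∑ n ∈ Ioc 0 N, vonMangoldt n) + E := by
    rw [hIcc, hE, ← Finset.sum_neg_distrib, ← Finset.sum_add_distrib]
    exact Finset.sum_congr rfl fun n _ => by ring
  have herr : |E| ≤ 2 * ∑ n ∈ (Ioc 0 N).filter (fun n => ¬ n.Prime), vonMangoldt n := by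
    rw [hE, Finset.mul_sum, Finset.sum_filter]
    refine (Finset.abs_sum_le_sum_abs _ _).trans (Finset.sum_le_sum fun n hn => ?_)
    have hn0 : n ≠ 0 := (Finset.mem_Ioc.mp hn).1.ne'
    by_cases hprime : n.Prime
    · rw [if_neg (not_not_intro hprime), liouville_prime hprime]
      simp
    · rw [if_pos hprime, abs_mul, abs_of_nonneg ArithmeticFunction.vonMangoldt_nonneg, mul_comm]
      have h2 : |((liouville n : ℤ) : ℝ) + 1| ≤ 2 := by
        calc |((liouville n : ℤ) : ℝ) + 1| ≤ |((liouville n : ℤ) : ℝ)| + |(1 : ℝ)| := abs_add_le _ _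
          _ = 2 := by rw [abs_cast_liouville hn0, abs_one]; norm_num
      exact mul_le_mul_of_nonneg_right h2 ArithmeticFunction.vonMangoldt_nonneg
  rw [hdecomp, ← hpsi]
  rw [← hdiff] at herr
  have htri : |(-Chebyshev.psi N + E) - E| ≤ |-Chebyshev.psi N + E| + |E| := abs_sub _ _
  rw [add_sub_cancel_right, abs_neg, abs_of_nonneg (Chebyshev.psi_nonneg _)] at htri
  linarith

/-- Real-variable bookkeeping: eventually `C x / log x + log (x+1) + 4 √x log x < x log 2`
(`log x = o(√x)`, Mathlib `isLittleO_log_rpow_atTop`). [folklore] -/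
theorem eventually_junk_lt (C : ℝ) :
    ∀ᶠ x : ℝ in atTop,
      C * x / Real.log x + Real.log (x + 1) + 4 * Real.sqrt x * Real.log x < x * Real.log 2 := by
  have hl2 : 0 < Real.log 2 := Real.log_pos one_lt_two
  have hc : 0 < Real.log 2 / 16 := by positivity
  have hlo := (isLittleO_log_rpow_atTop (one_half_pos : (0 : ℝ) < 1 / 2)).bound hc
  filter_upwards [hlo, Real.tendsto_log_atTop.eventually_ge_atTop (4 * |C| / Real.log 2 + 1),
    eventually_ge_atTop (16 : ℝ)] with x hx hlogC hx16
  have hx0 : 0 < x := by linarith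
  have hlogpos : 0 < Real.log x := by
    have : 0 ≤ 4 * |C| / Real.log 2 := by positivity
    linarith
  -- `log x ≤ (log 2 / 16) √x`
  have hsqrt : Real.log x ≤ Real.log 2 / 16 * Real.sqrt x := by
    rw [Real.norm_eq_abs, Real.norm_eq_abs, abs_of_pos hlogpos,
      abs_of_nonneg (Real.rpow_nonneg hx0.le _), ← Real.sqrt_eq_rpow] at hx
    exact hx
  have hsqrt_le : Real.sqrt x ≤ x := by
    rw [Real.sqrt_le_left (by linarith)]
    nlinarith
  -- (i) `C x / log x ≤ x log 2 / 4`
  have h1 : C * x / Real.log x ≤ x * Real.log 2 / 4 := by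
    rw [div_le_iff₀ hlogpos]
    have hC : |C| ≤ Real.log 2 / 4 * Real.log x := by
      have h' : 4 * |C| / Real.log 2 ≤ Real.log x := by linarith
      rw [div_le_iff₀ hl2] at h'
      linarith
    calc C * x ≤ |C| * x := by gcongr; exact le_abs_self C
      _ ≤ (Real.log 2 / 4 * Real.log x) * x := by gcongr
      _ = x * Real.log 2 / 4 * Real.log x := by ring
  -- (ii) `log (x+1) ≤ x log 2 / 4`
  have h2 : Real.log (x + 1) ≤ x * Real.log 2 / 4 := by
    have hle : Real.log (x + 1) ≤ Real.log 2 + Real.log x := by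
      rw [← Real.log_mul (by norm_num) hx0.ne']
      exact Real.log_le_log (by linarith) (by linarith)
    have : Real.log x ≤ Real.log 2 / 16 * x := hsqrt.trans (by gcongr)
    nlinarith
  -- (iii) `4 √x log x ≤ x log 2 / 4`
  have h3 : 4 * Real.sqrt x * Real.log x ≤ x * Real.log 2 / 4 := by
    have hs0 : 0 ≤ Real.sqrt x := Real.sqrt_nonneg x
    calc 4 * Real.sqrt x * Real.log x ≤ 4 * Real.sqrt x * (Real.log 2 / 16 * Real.sqrt x) := by
          gcongr
      _ = Real.log 2 / 4 * (Real.sqrt x * Real.sqrt x) := by ring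
      _ = x * Real.log 2 / 4 := by rw [Real.mul_self_sqrt hx0.le]; ring
  nlinarith

/-- **`h ≠ 0` is load-bearing.** The crux `LambdaLiouvilleLevel` with its guard `h ≠ 0` deleted
(everything else verbatim) is FALSE: at `h = 0` the `q = 1` term alone is
`|Σ_{n≤N} Λ(n)λ(n)| ≥ N log 2 - log(N+1) - 4√N log N` (Chebyshev), which beats `C N / log N` for
large `N`. Witness: `h = 0`, `A = 1`, `w ≡ 0`, `y ≡ N`. Hence every proof of the crux must use
`h ≠ 0`. [folklore] -/
theorem lambdaLiouvilleLevel_false_without_hne :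
    ¬ (∀ h : ℤ, ∃ ε₀ : ℝ, 0 < ε₀ ∧ ∀ A : ℝ, 0 < A → ∃ C : ℝ, ∃ N₀ : ℕ, ∀ N : ℕ, N₀ ≤ N →
      ∀ w y : ℕ → ℕ, (∀ q, y q ≤ N) →
        (∑ q ∈ Finset.Icc 1 ⌊(N : ℝ) ^ ε₀⌋₊,
          |∑ n ∈ (Finset.Icc 1 (y q)).filter (fun n : ℕ => n ≡ w q [MOD q]),
            ArithmeticFunction.vonMangoldt n *
              (ArithmeticFunction.liouville (Int.toNat ((n : ℤ) + h)) : ℝ)|) ≤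
          C * N / Real.log N ^ A) := by
  intro H
  obtain ⟨ε₀, hε₀, H⟩ := H 0
  obtain ⟨C, N₀, H⟩ := H 1 one_pos
  have hev := (eventually_junk_lt C).natCast_atTop
  obtain ⟨N, hjunk, hN⟩ := (hev.and (eventually_ge_atTop (max N₀ 1))).exists
  have hN₀ : N₀ ≤ N := le_trans (le_max_left _ _) hN
  have hN1 : 1 ≤ N := le_trans (le_max_right _ _) hN
  have key := H N hN₀ (fun _ => 0) (fun _ => N) (fun _ => le_rfl)
  have hle := Finset.single_le_sum
    (f := fun q => |∑ n ∈ (Icc 1 N).filter (fun n : ℕ => n ≡ 0 [MOD q]),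
      vonMangoldt n * ((liouville (Int.toNat ((n : ℤ) + 0)) : ℤ) : ℝ)|)
    (fun q _ => abs_nonneg _) (one_mem_Icc_floor_rpow hN1 hε₀.le)
  have hq1 : (∑ n ∈ (Icc 1 N).filter (fun n : ℕ => n ≡ 0 [MOD 1]),
      vonMangoldt n * ((liouville (Int.toNat ((n : ℤ) + 0)) : ℤ) : ℝ)) =
      ∑ n ∈ Icc 1 N, vonMangoldt n * ((liouville n : ℤ) : ℝ) := by
    rw [filter_modEq_one]
    refine Finset.sum_congr rfl fun n _ => ?_
    rw [add_zero, Int.toNat_natCast]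
  simp only [hq1] at hle
  have hup : |∑ n ∈ Icc 1 N, vonMangoldt n * ((liouville n : ℤ) : ℝ)| ≤ C * N / Real.log N := by
    have := hle.trans key
    rwa [Real.rpow_one] at this
  have hlow := psi_sub_le_abs_sum_vonMangoldt_mul_liouville N
  have hpsi := Chebyshev.psi_ge N
  have hpt := Chebyshev.psi_sub_theta_le (x := (N : ℝ)) (by exact_mod_cast hN1)
  linarith

/-! ## Load-bearing hypothesis 2: the height cap `∀ q, y q ≤ N` -/

/-- `S(Y+1) = S(Y) + Λ(Y+1) λ(Y+2)` for the shifted partial sums `S(Y) = Σ_{1≤n≤Y} Λ(n) λ(n+1)`.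
[folklore] -/
theorem shiftOneSum_succ (Y : ℕ) :
    (∑ n ∈ Icc 1 (Y + 1), vonMangoldt n * ((liouville (Int.toNat ((n : ℤ) + 1)) : ℤ) : ℝ)) =
      (∑ n ∈ Icc 1 Y, vonMangoldt n * ((liouville (Int.toNat ((n : ℤ) + 1)) : ℤ) : ℝ)) +
        vonMangoldt (Y + 1) * ((liouville (Y + 2) : ℤ) : ℝ) := by
  rw [Finset.sum_Icc_succ_top (by omega)]
  congr 2

/-- At a prime `p` the shifted partial sums jump by exactly `log p` in absolute value. [folklore] -/
theorem abs_shiftOneSum_jump {p : ℕ} (hp : p.Prime) :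
    |(∑ n ∈ Icc 1 p, vonMangoldt n * ((liouville (Int.toNat ((n : ℤ) + 1)) : ℤ) : ℝ)) -
        ∑ n ∈ Icc 1 (p - 1), vonMangoldt n * ((liouville (Int.toNat ((n : ℤ) + 1)) : ℤ) : ℝ)| =
      Real.log p := by
  obtain ⟨k, rfl⟩ : ∃ k, p = k + 1 := ⟨p - 1, by have := hp.one_le; omega⟩
  rw [Nat.add_sub_cancel, shiftOneSum_succ, add_sub_cancel_left, abs_mul,
    ArithmeticFunction.vonMangoldt_apply_prime hp, abs_cast_liouville (by omega), mul_one]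
  exact abs_of_nonneg (Real.log_nonneg (by exact_mod_cast hp.one_le))

/-- The shifted partial sums `Σ_{1≤n≤Y} Λ(n) λ(n+1)` are unbounded in `Y` (their jumps are).
[folklore] -/
theorem exists_lt_abs_shiftOneSum (B : ℝ) :
    ∃ Y : ℕ, B < |∑ n ∈ Icc 1 Y, vonMangoldt n * ((liouville (Int.toNat ((n : ℤ) + 1)) : ℤ) : ℝ)| := by
  obtain ⟨p, hpge, hp⟩ := Nat.exists_infinite_primes (⌈Real.exp (2 * |B|)⌉₊ + 1)
  have hlogp : 2 * |B| < Real.log p := by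
    have h1 : Real.exp (2 * |B|) < p := by
      calc Real.exp (2 * |B|) ≤ ⌈Real.exp (2 * |B|)⌉₊ := Nat.le_ceil _
        _ < ((⌈Real.exp (2 * |B|)⌉₊ + 1 : ℕ) : ℝ) := by push_cast; linarith
        _ ≤ p := by exact_mod_cast hpge
    calc 2 * |B| = Real.log (Real.exp (2 * |B|)) := (Real.log_exp _).symm
      _ < Real.log p := Real.log_lt_log (Real.exp_pos _) h1
  have hjump := abs_shiftOneSum_jump hp
  by_contra hcon
  push Not at hcon
  have h1 := hcon p
  have h2 := hcon (p - 1)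
  have htri := abs_sub
    (∑ n ∈ Icc 1 p, vonMangoldt n * ((liouville (Int.toNat ((n : ℤ) + 1)) : ℤ) : ℝ))
    (∑ n ∈ Icc 1 (p - 1), vonMangoldt n * ((liouville (Int.toNat ((n : ℤ) + 1)) : ℤ) : ℝ))
  have hB : B ≤ |B| := le_abs_self B
  linarith

/-- **The height cap is load-bearing.** The crux `LambdaLiouvilleLevel` with `∀ q, y q ≤ N`
deleted (everything else verbatim) is FALSE: freeze `N = max N₀ 1`; the right side is the constant
`C N / log N`, but the `q = 1` term with `y 1 = Y` is `|Σ_{n≤Y} Λ(n)λ(n+1)|`, unbounded in `Y`.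
Witness: `h = 1`, `A = 1`, `w ≡ 0`, `y ≡ Y` large. Hence every proof of the crux must use the
height cap. [folklore] -/
theorem lambdaLiouvilleLevel_false_without_heightCap :
    ¬ (∀ h : ℤ, h ≠ 0 → ∃ ε₀ : ℝ, 0 < ε₀ ∧ ∀ A : ℝ, 0 < A → ∃ C : ℝ, ∃ N₀ : ℕ, ∀ N : ℕ, N₀ ≤ N →
      ∀ w y : ℕ → ℕ,
        (∑ q ∈ Finset.Icc 1 ⌊(N : ℝ) ^ ε₀⌋₊,
          |∑ n ∈ (Finset.Icc 1 (y q)).filter (fun n : ℕ => n ≡ w q [MOD q]),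
            ArithmeticFunction.vonMangoldt n *
              (ArithmeticFunction.liouville (Int.toNat ((n : ℤ) + h)) : ℝ)|) ≤
          C * N / Real.log N ^ A) := by
  intro H
  obtain ⟨ε₀, hε₀, H⟩ := H 1 one_ne_zero
  obtain ⟨C, N₀, H⟩ := H 1 one_pos
  set N : ℕ := max N₀ 1 with hNdef
  have hN₀ : N₀ ≤ N := le_max_left _ _
  have hN1 : 1 ≤ N := le_max_right _ _
  obtain ⟨Y, hY⟩ := exists_lt_abs_shiftOneSum (C * N / Real.log N ^ (1 : ℝ))
  have key := H N hN₀ (fun _ => 0) (fun _ => Y)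
  have hle := Finset.single_le_sum
    (f := fun q => |∑ n ∈ (Icc 1 Y).filter (fun n : ℕ => n ≡ 0 [MOD q]),
      vonMangoldt n * ((liouville (Int.toNat ((n : ℤ) + 1)) : ℤ) : ℝ)|)
    (fun q _ => abs_nonneg _) (one_mem_Icc_floor_rpow hN1 hε₀.le)
  simp only [filter_modEq_one] at hle
  linarith [hle.trans key]

end Summit.Parity.GeneralizedHardyLittlewood.Theorems.LambdaLiouvilleLevel.Negative
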